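import Mathlib
import Summits.Ventures.HodgeRepro.Tier4.Common.KTypeSpace
import Summits.Ventures.HodgeRepro.Tier4.Line4.RieszOnKType

/-!
# Tier4/Line4/KTypeJoint — the JOINT `(T, T′)`-equivariance of `kTypeSpace` at one infinite place: a word in the two
local tori equal to `1` whose weight product is `≠ 1` forces `kTypeSpace … K V = ⊥`

Blind re-derivation cell `pub-hodge-repro`, Tier 4 «prove the step» (README §9–§10), seat t4-L4-p2 (prover, LINE L4,
gen 3; bus S13737).  Tree path `lean/Summits/Ventures/HodgeRepro/Tier4/Line4/KTypeJoint.lean`.  Mathlib-level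
(a finite product of equivariance identities); no literature.

WHAT IS PROVED.  typer-2's `Common.kTypeSpace W q g g' eP eM eP' eM' K V` (Common/KTypeSpace) asks of `f ∈ V` the
JOINT right-equivariance under the local torus `localTorusAt W w` of `T` (weights `(eP w, eM w)`) AND under the local
torus `localTorusAt' W w` of the transported `T′` (weights `(eP' w, eM' w)`) at EVERY infinite place `w`, and
`K`-invariance.  A `(T, T′)`-WORD at `w` is a list of pairs `(κ, b)` with `κ ∈ localTorusAt W w` when `b = true` and
`κ ∈ localTorusAt' W w` when `b = false`; its weight is the product of the corresponding weight characters.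
* `kTypeSpace_apply_mul_word`: for `f` in the `K`-type space, `f (x · ∏ κ) = (∏ weights) · f x`;
* **`kTypeSpace_eq_bot_of_word`**: a word with `∏ κ = 1` and `∏ weights ≠ 1` forces `kTypeSpace … K V = ⊥` for EVERY
  `V` and EVERY level `K` — the two tori generate a relation the joint weights do not respect, so only `0` is jointly
  equivariant;
* `not_exists_isRieszVectorOn_of_word`: on such data the clause `∃ f, IsRieszVectorOn R μ DG (kTypeSpace …) f`
  (t4-L4-p1's `Line4/RieszOnKType`, which contains `f ≠ 0` and `f ∈ kTypeSpace …`) is FALSE — this is the conclusion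
  of the wall `mixed_two_torus_W3` (Skeleton v0.20 L498–L531) with the `K`-type space instantiated on the line's
  seesaw plane; hence the wall's conclusion fails on every instance of its binders carrying such a word at `w₀`;
* `eq_zero_of_left_equivariant_of_word`: a function LEFT-equivariant under both local tori at every place with these
  weights (the hypotheses `hfT`, `hfT'` of t4-L4-p1's `KTypeTransport.rightRegular_mem_kTypeSpace` — the «bi-`(τ,K)`-finite
  test functions» of the residual (b′)) is `0` as soon as one such word exists at one place.

WHY THIS MATTERS (the paper argument, proofs/t4/L4/KTYPE-JOINT-FINDING.md): at `w₀` the seesaw plane is `U(1,1)`, and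
`localTorusAt W w₀`, `localTorusAt' W w₀` are two MAXIMAL COMPACT tori of `U(1,1)(k_{w₀})` (`U(1) × U(1)` and its
transport by `g_{w₀}`), equal iff `g_{w₀}` preserves the pair of lines — which the wall's binders (`_hiso`: `g B_{U′} gᵀ =
λ B_U` for ANY similitude `g`) do not force.  Two distinct maximal compact tori of `U(1,1)(ℝ)` generate a subgroup
containing `SU(1,1)`; a relation among them with a non-trivial weight defect (the hyperbolic angle defect of an
isosceles triangle) exists, with `|eP w₀ − eM w₀| = 3` (the wall's `_he`) feeding the defect.  An explicit rational
instance (a boost `g` with `cosh = 5/3`, `sinh = 4/3`, Pythagorean torus elements) is recorded at the matrix level in a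
companion module (this seat's next proposal).  This module is the GENERAL half: the vanishing from any such word.

Nothing here says anything about the status of the Hodge conjecture for CM abelian varieties, which is NOT proved
(HC_CM is NOT proved by anyone in this repository).
-/

set_option autoImplicit false

noncomputable section

namespace Summit.Ventures.HodgeRepro.Tier4.Line4

open Summit.Ventures.HodgeRepro.Tier4.Common NumberField

section Word

variable {k : Type} [Field k] [NumberField k] (W : PlaneData k)

/-- **The joint weight character at `w`** of a pair `(κ, b)`: the `T`-weight `κ₊^{eP w} κ₋^{eM w}` when `b = true`,
the `T′`-weight `κ₊′^{eP' w} κ₋′^{eM' w}` (read in the transported frame, `weightAt'`) when `b = false`. -/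
def jointWeight (q : QuadData k) (w : InfinitePlace k) (g g' : Matrix (Fin 4) (Fin 4) k)
    (eP eM eP' eM' : InfinitePlace k → ℤ) (p : GA W × Bool) : ℂ :=
  if p.2 then weightAt W q w 0 p.1 ^ eP w * weightAt W q w 1 p.1 ^ eM w
  else weightAt' W q w g g' 0 p.1 ^ eP' w * weightAt' W q w g g' 1 p.1 ^ eM' w

/-- **A `(T, T′)`-word at `w`**: every letter tagged `true` lies in the local torus of `T` at `w`, every letter tagged
`false` in the local torus of the transported `T′` at `w`. -/
def IsJointWord (w : InfinitePlace k) (l : List (GA W × Bool)) : Prop :=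
  ∀ p ∈ l, (p.2 = true → p.1 ∈ localTorusAt W w) ∧ (p.2 = false → p.1 ∈ localTorusAt' W w)

/-- The product of the letters of a word. -/
def wordProd (l : List (GA W × Bool)) : GA W := (l.map Prod.fst).prod

/-- The product of the weights of a word. -/
def wordWeight (q : QuadData k) (w : InfinitePlace k) (g g' : Matrix (Fin 4) (Fin 4) k)
    (eP eM eP' eM' : InfinitePlace k → ℤ) (l : List (GA W × Bool)) : ℂ :=
  (l.map (jointWeight W q w g g' eP eM eP' eM')).prod

/-- The empty word has product `1`. -/
theorem wordProd_nil : wordProd W ([] : List (GA W × Bool)) = 1 := rfl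

/-- The product of a word with a first letter. -/
theorem wordProd_cons (p : GA W × Bool) (l : List (GA W × Bool)) :
    wordProd W (p :: l) = p.1 * wordProd W l := by
  simp [wordProd]

/-- The empty word has weight `1`. -/
theorem wordWeight_nil (q : QuadData k) (w : InfinitePlace k) (g g' : Matrix (Fin 4) (Fin 4) k)
    (eP eM eP' eM' : InfinitePlace k → ℤ) : wordWeight W q w g g' eP eM eP' eM' [] = 1 := rfl

/-- The weight of a word with a first letter. -/
theorem wordWeight_cons (q : QuadData k) (w : InfinitePlace k) (g g' : Matrix (Fin 4) (Fin 4) k)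
    (eP eM eP' eM' : InfinitePlace k → ℤ) (p : GA W × Bool) (l : List (GA W × Bool)) :
    wordWeight W q w g g' eP eM eP' eM' (p :: l) =
      jointWeight W q w g g' eP eM eP' eM' p * wordWeight W q w g g' eP eM eP' eM' l := by
  simp [wordWeight]

/-- A member of the `K`-type space transforms under ONE letter by its joint weight. -/
theorem kTypeSpace_apply_mul_letter (q : QuadData k) (w : InfinitePlace k) (g g' : Matrix (Fin 4) (Fin 4) k)
    (eP eM eP' eM' : InfinitePlace k → ℤ) (K : Subgroup (GA W)) (V : Submodule ℂ (GA W → ℂ))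
    {f : GA W → ℂ} (hf : f ∈ kTypeSpace W q g g' eP eM eP' eM' K V) (p : GA W × Bool)
    (hp : (p.2 = true → p.1 ∈ localTorusAt W w) ∧ (p.2 = false → p.1 ∈ localTorusAt' W w)) (x : GA W) :
    f (x * p.1) = jointWeight W q w g g' eP eM eP' eM' p * f x := by
  obtain ⟨_, hT, hT', _⟩ := hf
  unfold jointWeight
  cases hb : p.2
  · simp only [Bool.false_eq_true, ↓reduceIte]
    exact hT' w x p.1 (hp.2 hb)
  · simp only [↓reduceIte]
    exact hT w x p.1 (hp.1 hb)

/-- **A member of the `K`-type space transforms under a `(T, T′)`-word by the product of the joint weights.** -/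
theorem kTypeSpace_apply_mul_word (q : QuadData k) (w : InfinitePlace k) (g g' : Matrix (Fin 4) (Fin 4) k)
    (eP eM eP' eM' : InfinitePlace k → ℤ) (K : Subgroup (GA W)) (V : Submodule ℂ (GA W → ℂ))
    {f : GA W → ℂ} (hf : f ∈ kTypeSpace W q g g' eP eM eP' eM' K V) (l : List (GA W × Bool))
    (hl : IsJointWord W w l) (x : GA W) :
    f (x * wordProd W l) = wordWeight W q w g g' eP eM eP' eM' l * f x := by
  induction l generalizing x with
  | nil => simp [wordProd, wordWeight]
  | cons p l ih =>
    have hp : (p.2 = true → p.1 ∈ localTorusAt W w) ∧ (p.2 = false → p.1 ∈ localTorusAt' W w) :=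
      hl p (List.mem_cons_self ..)
    have hl' : IsJointWord W w l := fun p' hp' => hl p' (List.mem_cons_of_mem _ hp')
    rw [wordProd_cons, wordWeight_cons, ← mul_assoc, ih hl' (x * p.1),
      kTypeSpace_apply_mul_letter W q w g g' eP eM eP' eM' K V hf p hp x]
    ring

/-- **THE VANISHING**: a `(T, T′)`-word at `w` with product `1` and weight product `≠ 1` forces
`kTypeSpace W q g g' eP eM eP' eM' K V = ⊥` for EVERY `V` and EVERY level `K`. -/
theorem kTypeSpace_eq_bot_of_word (q : QuadData k) (w : InfinitePlace k) (g g' : Matrix (Fin 4) (Fin 4) k)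
    (eP eM eP' eM' : InfinitePlace k → ℤ) (K : Subgroup (GA W)) (V : Submodule ℂ (GA W → ℂ))
    (l : List (GA W × Bool)) (hl : IsJointWord W w l) (hprod : wordProd W l = 1)
    (hwt : wordWeight W q w g g' eP eM eP' eM' l ≠ 1) :
    kTypeSpace W q g g' eP eM eP' eM' K V = ⊥ := by
  rw [eq_bot_iff]
  intro f hf
  rw [Submodule.mem_bot]
  funext x
  have h := kTypeSpace_apply_mul_word W q w g g' eP eM eP' eM' K V hf l hl x
  rw [hprod, mul_one] at h
  have h' : (wordWeight W q w g g' eP eM eP' eM' l - 1) * f x = 0 := by linear_combination -h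
  rcases mul_eq_zero.1 h' with h0 | h0
  · exact absurd (sub_eq_zero.1 h0) hwt
  · exact h0

end Word

section Riesz

variable {k : Type} [Field k] [NumberField k] {W : PlaneData k}
  [MeasurableSpace (torusT W)] [MeasurableSpace (torusT' W)] (R : RTFData W)
  [MeasurableSpace (GA W)] (μ : MeasureTheory.Measure (GA W)) (DG : Set (GA W))

/-- No Riesz vector lives on a zero `K`-type space: `IsRieszVectorOn` contains `f ∈ Vτ` and `f ≠ 0`. -/
theorem not_isRieszVectorOn_bot (f : GA W → ℂ) : ¬ IsRieszVectorOn R μ DG (⊥ : Submodule ℂ (GA W → ℂ)) f := by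
  rintro ⟨hf, hne, -⟩
  exact hne ((Submodule.mem_bot ℂ).1 hf)

/-- **The wall's conclusion fails on a `(T, T′)`-word**: with a word at `w` of product `1` and weight product `≠ 1`,
no `f` is a Riesz vector on `kTypeSpace W q g g' eP eM eP' eM' K V`, for ANY `V`, `K`, `R`, `μ`, `D_G`. -/
theorem not_exists_isRieszVectorOn_of_word (q : QuadData k) (w : InfinitePlace k)
    (g g' : Matrix (Fin 4) (Fin 4) k) (eP eM eP' eM' : InfinitePlace k → ℤ) (K : Subgroup (GA W))
    (V : Submodule ℂ (GA W → ℂ)) (l : List (GA W × Bool)) (hl : IsJointWord W w l) (hprod : wordProd W l = 1)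
    (hwt : wordWeight W q w g g' eP eM eP' eM' l ≠ 1) :
    ¬ ∃ f : GA W → ℂ, IsRieszVectorOn R μ DG (kTypeSpace W q g g' eP eM eP' eM' K V) f := by
  rintro ⟨f, hf⟩
  rw [kTypeSpace_eq_bot_of_word W q w g g' eP eM eP' eM' K V l hl hprod hwt] at hf
  exact not_isRieszVectorOn_bot R μ DG f hf

end Riesz

section LeftEquivariant

variable {k : Type} [Field k] [NumberField k] (W : PlaneData k)

/-- A LEFT-equivariant function transforms under one letter (on the left, by the inverse) by the joint weight. -/
theorem left_equivariant_apply_inv_mul_letter (q : QuadData k) (w : InfinitePlace k)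
    (g g' : Matrix (Fin 4) (Fin 4) k) (eP eM eP' eM' : InfinitePlace k → ℤ) (f : GA W → ℂ)
    (hfT : ∀ κ : GA W, κ ∈ localTorusAt W w → ∀ y,
      f (κ⁻¹ * y) = weightAt W q w 0 κ ^ eP w * weightAt W q w 1 κ ^ eM w * f y)
    (hfT' : ∀ κ : GA W, κ ∈ localTorusAt' W w → ∀ y,
      f (κ⁻¹ * y) = weightAt' W q w g g' 0 κ ^ eP' w * weightAt' W q w g g' 1 κ ^ eM' w * f y)
    (p : GA W × Bool) (hp : (p.2 = true → p.1 ∈ localTorusAt W w) ∧ (p.2 = false → p.1 ∈ localTorusAt' W w))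
    (y : GA W) : f (p.1⁻¹ * y) = jointWeight W q w g g' eP eM eP' eM' p * f y := by
  unfold jointWeight
  cases hb : p.2
  · simp only [Bool.false_eq_true, ↓reduceIte]
    exact hfT' p.1 (hp.2 hb) y
  · simp only [↓reduceIte]
    exact hfT p.1 (hp.1 hb) y

/-- A LEFT-equivariant function transforms under a word by the product of the joint weights:
`f ((∏ κ)⁻¹ · y) = (∏ weights) · f y`. -/
theorem left_equivariant_apply_inv_mul_word (q : QuadData k) (w : InfinitePlace k)
    (g g' : Matrix (Fin 4) (Fin 4) k) (eP eM eP' eM' : InfinitePlace k → ℤ) (f : GA W → ℂ)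
    (hfT : ∀ κ : GA W, κ ∈ localTorusAt W w → ∀ y,
      f (κ⁻¹ * y) = weightAt W q w 0 κ ^ eP w * weightAt W q w 1 κ ^ eM w * f y)
    (hfT' : ∀ κ : GA W, κ ∈ localTorusAt' W w → ∀ y,
      f (κ⁻¹ * y) = weightAt' W q w g g' 0 κ ^ eP' w * weightAt' W q w g g' 1 κ ^ eM' w * f y)
    (l : List (GA W × Bool)) (hl : IsJointWord W w l) (y : GA W) :
    f ((wordProd W l)⁻¹ * y) = wordWeight W q w g g' eP eM eP' eM' l * f y := by
  induction l generalizing y with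
  | nil => simp [wordProd, wordWeight]
  | cons p l ih =>
    have hp : (p.2 = true → p.1 ∈ localTorusAt W w) ∧ (p.2 = false → p.1 ∈ localTorusAt' W w) :=
      hl p (List.mem_cons_self ..)
    have hl' : IsJointWord W w l := fun p' hp' => hl p' (List.mem_cons_of_mem _ hp')
    rw [wordProd_cons, wordWeight_cons, mul_inv_rev, mul_assoc, ih hl' (p.1⁻¹ * y),
      left_equivariant_apply_inv_mul_letter W q w g g' eP eM eP' eM' f hfT hfT' p hp y]
    ring

/-- **A bi-`(T, T′)`-equivariant function is `0` on a word**: the left-equivariance hypotheses `hfT`, `hfT'` of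
t4-L4-p1's `KTypeTransport.rightRegular_mem_kTypeSpace` (at the one place `w`) together with a `(T, T′)`-word at `w` of
product `1` and weight product `≠ 1` force `f = 0`. -/
theorem eq_zero_of_left_equivariant_of_word (q : QuadData k) (w : InfinitePlace k)
    (g g' : Matrix (Fin 4) (Fin 4) k) (eP eM eP' eM' : InfinitePlace k → ℤ) (f : GA W → ℂ)
    (hfT : ∀ κ : GA W, κ ∈ localTorusAt W w → ∀ y,
      f (κ⁻¹ * y) = weightAt W q w 0 κ ^ eP w * weightAt W q w 1 κ ^ eM w * f y)
    (hfT' : ∀ κ : GA W, κ ∈ localTorusAt' W w → ∀ y,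
      f (κ⁻¹ * y) = weightAt' W q w g g' 0 κ ^ eP' w * weightAt' W q w g g' 1 κ ^ eM' w * f y)
    (l : List (GA W × Bool)) (hl : IsJointWord W w l) (hprod : wordProd W l = 1)
    (hwt : wordWeight W q w g g' eP eM eP' eM' l ≠ 1) : f = 0 := by
  funext y
  have h := left_equivariant_apply_inv_mul_word W q w g g' eP eM eP' eM' f hfT hfT' l hl y
  rw [hprod, inv_one, one_mul] at h
  have h' : (wordWeight W q w g g' eP eM eP' eM' l - 1) * f y = 0 := by linear_combination -h
  rcases mul_eq_zero.1 h' with h0 | h0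
  · exact absurd (sub_eq_zero.1 h0) hwt
  · exact h0

end LeftEquivariant

end Summit.Ventures.HodgeRepro.Tier4.Line4

end
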